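import Mathlib
import Literature.Probability.Percolation.PercolationProofs
import Literature.Probability.Percolation.ConditionalPositiveAssociation
import Literature.Probability.Percolation.ConditionalPositiveAssociationProofs
import Literature.Probability.Percolation.TwoClusterConditionalAssociation
import Literature.Probability.Percolation.TwoClusterConditionalAssociationProofs
import Summits.CriticalPhenomena.PercolationContinuityZ3.Theorems.PercNearOneGluingAdditiveGluingBhkSetsAux
import HarnessLib

/-!
# Crux `PercNearOneGluing.AdditiveGluing` (stmt-CriticalPhenomena-4576), line `replica-splice-at-entrance` —
# stub `stub_bhkSets` (van den Berg–Häggström–Kahn for the open cluster of a vertex SET)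

Helper file for the crux skeleton of the line `replica-splice-at-entrance` (lead
prover-line-stmt-CriticalPhenomena-4576-c3-0): proves exactly the registered stub signature
`stub_bhkSets`; lands with `--supports stmt-CriticalPhenomena-4576`.

## Content

Finite weighted graph on `Fin n` (`μ = prodBernoulli w` on `BondConfig (Fin n) = Set (Sym2 (Fin n))`,
every pair `e` open independently with probability `w e`), `C_s(ω) = openEdgeCluster ω s` the open edge
cluster of van den Berg–Häggström–Kahn, and for a vertex set `S` put `C_S := ⋃_{s ∈ S} C_s` and
`{S ↮ X} := {ω | ∀ s ∈ S, ∀ x ∈ X, s ↮ x}`.  Kozma–Nitzan (arXiv:2401.12397, §2.2) use BHK 2006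
(RSA 29, Thms. 1.3 and 1.4) in the following SET form, in denominator-free notation:

* (i) for `F, G` increasing, `(∫_{S ↮ X} F(C_S))(∫_{S ↮ X} G(C_S)) ≤ μ(S ↮ X) · ∫_{S ↮ X} F(C_S) G(C_S)`;
* (ii) for `F, G` increasing, `μ(S ↮ S') · ∫_{S ↮ S'} F(C_S) G(C_{S'}) ≤ (∫_{S ↮ S'} F(C_S))(∫_{S ↮ S'} G(C_{S'}))`.

The tree has both theorems for singleton sources (`BHK2006_clusterConditionalPositiveAssociation_holds`,
`BHK2006_twoClusterConditionalAssociation_holds` with its corollary `….negCorrelation`).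

## Proof: hub augmentation (file `…BhkSetsAux`)

Add a hub `none` to the vertex type (`Option (Fin n)`), joined to every `s ∈ S` by a weight-`1` pair, all
other new pairs of weight `0`, old pairs keeping their weights (`hubW⟦S, w⟧`).  The augmented law is the
image of `μ` under the lift `η ↦ (old pairs of η) ∪ (hub pairs)` (`bhkHub_integral`), the hub is joined
to `some x` iff `S ↔ x` (`bhkHub_reachable_none_some`), and the old pairs of the cluster of the hub are
exactly `C_S` (`bhkHub_preimage_cluster_none`).  So (i) is Thm. 1.3 on `Option (Fin n)` for the source
`none`, the conditioning set `some '' X` and the increasing functions `F ∘ (old pairs)`, `G ∘ (old pairs)`,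
transported along the lift.  For (ii) augment twice: an inner hub joined to `S'` and an outer hub joined
to (the copies of) `S`; given `{S ↮ S'}` the inner hub is not joined to the outer attachment set, so its
cluster keeps its old pairs (`bhkHub_preimage_cluster_some`), and (ii) is Thm. 1.4 (`….negCorrelation`)
for the two hubs, transported along the double lift.
-/

namespace Summit.CriticalPhenomena.PercolationContinuityZ3.Theorems

open MeasureTheory Set Literature.Probability.LatticeModels Literature.Probability.Percolation
open scoped Classical BigOperators

noncomputable section

/-- `hubLift⟦A, η⟧`: the hub lift of a configuration (file-local notation for the tree term, as in the
sibling file `…BhkSetsAux`): the old pairs of `η` through `some` plus the hub pairs `s(none, some a)`,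
`a ∈ A`. -/
local notation3 (prettyPrint := false) "hubLift⟦" A ", " η "⟧" =>
  (Sym2.map some '' η ∪ {e | ∃ a ∈ A, e = s(none, some a)})

/-- `hubW⟦A, w⟧`: the augmented weights (file-local notation for the tree term, as in `…BhkSetsAux`):
`w` on the old pairs, `1` on the hub pairs `s(none, some a)`, `a ∈ A`, `0` on the other new pairs. -/
local notation3 (prettyPrint := false) "hubW⟦" A ", " w "⟧" =>
  (Function.extend (Sym2.map some) w fun e =>
    @ite unitInterval (∃ a ∈ A, e = s(none, some a)) (Classical.dec _) 1 0)

/-! ### Transport of set integrals and probabilities along a map -/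

/-- Transport of a set integral along a map `L` with `∫ h dν = ∫ h ∘ L dμ` for all `h`, an event `D'`
pulling back to `D`, and integrands agreeing on `D`. -/
theorem bhkHub_setIntegral_transfer {α β : Type*} [MeasurableSpace α] [MeasurableSpace β]
    [DiscreteMeasurableSpace α] [DiscreteMeasurableSpace β] {μ : Measure α} {ν : Measure β}
    {L : α → β} (hL : ∀ h : β → ℝ, ∫ b, h b ∂ν = ∫ a, h (L a) ∂μ) {D : Set α} {D' : Set β}
    (hD : ∀ a, L a ∈ D' ↔ a ∈ D) {Φ : β → ℝ} {Ψ : α → ℝ} (hΦ : ∀ a ∈ D, Φ (L a) = Ψ a) :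
    ∫ b in D', Φ b ∂ν = ∫ a in D, Ψ a ∂μ := by
  rw [← integral_indicator MeasurableSet.of_discrete, hL,
    ← integral_indicator MeasurableSet.of_discrete]
  refine integral_congr_ae (Filter.Eventually.of_forall fun a => ?_)
  show D'.indicator Φ (L a) = D.indicator Ψ a
  by_cases ha : a ∈ D
  · rw [indicator_of_mem ((hD a).2 ha), indicator_of_mem ha, hΦ a ha]
  · rw [indicator_of_notMem (fun h => ha ((hD a).1 h)), indicator_of_notMem ha]

/-- Transport of the probability of an event along a map `L` with `∫ h dν = ∫ h ∘ L dμ` for all `h`. -/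
theorem bhkHub_measureReal_transfer {α β : Type*} [MeasurableSpace α] [MeasurableSpace β]
    [DiscreteMeasurableSpace α] [DiscreteMeasurableSpace β] {μ : Measure α} {ν : Measure β}
    {L : α → β} (hL : ∀ h : β → ℝ, ∫ b, h b ∂ν = ∫ a, h (L a) ∂μ) {D : Set α} {D' : Set β}
    (hD : ∀ a, L a ∈ D' ↔ a ∈ D) : ν.real D' = μ.real D := by
  rw [← integral_indicator_one MeasurableSet.of_discrete, hL,
    ← integral_indicator_one MeasurableSet.of_discrete]
  refine integral_congr_ae (Filter.Eventually.of_forall fun a => ?_)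
  show D'.indicator 1 (L a) = D.indicator 1 a
  by_cases ha : a ∈ D
  · rw [indicator_of_mem ((hD a).2 ha), indicator_of_mem ha]
    rfl
  · rw [indicator_of_notMem (fun h => ha ((hD a).1 h)), indicator_of_notMem ha]

/-! ### BHK for set sources -/

/-- **van den Berg–Häggström–Kahn (2006), Thms. 1.3 and 1.4, for the open cluster of a vertex SET**
(the form used by Kozma–Nitzan, arXiv:2401.12397 §2.2).  With `C_S(ω) := ⋃ s ∈ S, openEdgeCluster ω s`:
(i) for `F, G` monotone and `D := {S ↮ X}`,
`(∫_D F(C_S))(∫_D G(C_S)) ≤ μ(D) · ∫_D F(C_S) G(C_S)`; (ii) for `F, G` monotone and `D := {S ↮ S'}`,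
`μ(D) · ∫_D F(C_S) G(C_{S'}) ≤ (∫_D F(C_S))(∫_D G(C_{S'}))`.  Proof by hub augmentation: the singleton
theorems `BHK2006_clusterConditionalPositiveAssociation_holds` (Thm. 1.3) and
`BHK2006_twoClusterConditionalAssociation_holds.negCorrelation` (Thm. 1.4) on `Option (Fin n)`
(resp. `Option (Option (Fin n))`) for hub sources, transported along the lift of configurations
(`bhkHub_integral`, `bhkHub_reachable_none_some`, `bhkHub_preimage_cluster_none/some`). -/
theorem stub_bhkSets :
    (∀ (n : ℕ) (w : Sym2 (Fin n) → unitInterval) (S : Finset (Fin n)) (X : Set (Fin n))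
        (F G : Set (Sym2 (Fin n)) → ℝ), Monotone F → Monotone G → (∀ s ∈ S, s ∉ X) →
        (∫ ω in {ω : BondConfig (Fin n) | ∀ s ∈ S, ∀ x ∈ X, ¬ (openGraph ω).Reachable s x},
            F (⋃ s ∈ S, openEdgeCluster ω s) ∂(prodBernoulli w)) *
          (∫ ω in {ω : BondConfig (Fin n) | ∀ s ∈ S, ∀ x ∈ X, ¬ (openGraph ω).Reachable s x},
            G (⋃ s ∈ S, openEdgeCluster ω s) ∂(prodBernoulli w)) ≤
        (prodBernoulli w).real {ω : BondConfig (Fin n) | ∀ s ∈ S, ∀ x ∈ X, ¬ (openGraph ω).Reachable s x} *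
          ∫ ω in {ω : BondConfig (Fin n) | ∀ s ∈ S, ∀ x ∈ X, ¬ (openGraph ω).Reachable s x},
            F (⋃ s ∈ S, openEdgeCluster ω s) * G (⋃ s ∈ S, openEdgeCluster ω s) ∂(prodBernoulli w)) ∧
    (∀ (n : ℕ) (w : Sym2 (Fin n) → unitInterval) (S S' : Finset (Fin n))
        (F G : Set (Sym2 (Fin n)) → ℝ), Monotone F → Monotone G → Disjoint S S' →
        (prodBernoulli w).real {ω : BondConfig (Fin n) | ∀ s ∈ S, ∀ x ∈ S', ¬ (openGraph ω).Reachable s x} *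
          (∫ ω in {ω : BondConfig (Fin n) | ∀ s ∈ S, ∀ x ∈ S', ¬ (openGraph ω).Reachable s x},
            F (⋃ s ∈ S, openEdgeCluster ω s) * G (⋃ s ∈ S', openEdgeCluster ω s) ∂(prodBernoulli w)) ≤
        (∫ ω in {ω : BondConfig (Fin n) | ∀ s ∈ S, ∀ x ∈ S', ¬ (openGraph ω).Reachable s x},
            F (⋃ s ∈ S, openEdgeCluster ω s) ∂(prodBernoulli w)) *
          (∫ ω in {ω : BondConfig (Fin n) | ∀ s ∈ S, ∀ x ∈ S', ¬ (openGraph ω).Reachable s x},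
            G (⋃ s ∈ S', openEdgeCluster ω s) ∂(prodBernoulli w))) := by
  refine ⟨?_, ?_⟩
  · /- (i): one hub `none : Option (Fin n)` attached to `S`; BHK Thm. 1.3 for the source `none` and the
    conditioning set `some '' X`, transported along the lift. -/
    intro n w S X F G hF hG _
    set X' : Set (Option (Fin n)) := some '' X with hX'
    set F' : Set (Sym2 (Option (Fin n))) → ℝ := fun C => F (Sym2.map some ⁻¹' C) with hF'
    set G' : Set (Sym2 (Option (Fin n))) → ℝ := fun C => G (Sym2.map some ⁻¹' C) with hG'
    have hF'm : Monotone F' := fun C C' h => hF (preimage_mono h)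
    have hG'm : Monotone G' := fun C C' h => hG (preimage_mono h)
    have hnone : (none : Option (Fin n)) ∉ X' := by
      rintro ⟨x, -, hx⟩
      exact Option.some_ne_none x hx
    have key := BHK2006_clusterConditionalPositiveAssociation_holds (Option (Fin n))
      hubW⟦S, w⟧ none X' F' G' hF'm hG'm hnone
    have hL := bhkHub_integral S w
    have hD : ∀ η : Set (Sym2 (Fin n)),
        hubLift⟦S, η⟧ ∈ {ω' : BondConfig (Option (Fin n)) |
            ∀ x ∈ X', ¬ (openGraph ω').Reachable none x} ↔
          η ∈ {ω : BondConfig (Fin n) | ∀ s ∈ S, ∀ x ∈ X, ¬ (openGraph ω).Reachable s x} := by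
      intro η
      simp only [mem_setOf_eq, hX', forall_mem_image, bhkHub_reachable_none_some, not_exists,
        not_and]
      exact ⟨fun h s hs x hx => h hx s hs, fun h x hx s hs => h s hs x hx⟩
    have hC : ∀ η : Set (Sym2 (Fin n)),
        Sym2.map some ⁻¹' openEdgeCluster (hubLift⟦S, η⟧) none = ⋃ s ∈ S, openEdgeCluster η s :=
      bhkHub_preimage_cluster_none S
    have e1 : ∫ ω' in {ω' : BondConfig (Option (Fin n)) | ∀ x ∈ X', ¬ (openGraph ω').Reachable none x},
          F' (openEdgeCluster ω' none) ∂(prodBernoulli hubW⟦S, w⟧) =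
        ∫ ω in {ω : BondConfig (Fin n) | ∀ s ∈ S, ∀ x ∈ X, ¬ (openGraph ω).Reachable s x},
          F (⋃ s ∈ S, openEdgeCluster ω s) ∂(prodBernoulli w) :=
      bhkHub_setIntegral_transfer hL hD fun η _ => by simp only [hF', hC]
    have e2 : ∫ ω' in {ω' : BondConfig (Option (Fin n)) | ∀ x ∈ X', ¬ (openGraph ω').Reachable none x},
          G' (openEdgeCluster ω' none) ∂(prodBernoulli hubW⟦S, w⟧) =
        ∫ ω in {ω : BondConfig (Fin n) | ∀ s ∈ S, ∀ x ∈ X, ¬ (openGraph ω).Reachable s x},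
          G (⋃ s ∈ S, openEdgeCluster ω s) ∂(prodBernoulli w) :=
      bhkHub_setIntegral_transfer hL hD fun η _ => by simp only [hG', hC]
    have e3 : ∫ ω' in {ω' : BondConfig (Option (Fin n)) | ∀ x ∈ X', ¬ (openGraph ω').Reachable none x},
          F' (openEdgeCluster ω' none) * G' (openEdgeCluster ω' none)
            ∂(prodBernoulli hubW⟦S, w⟧) =
        ∫ ω in {ω : BondConfig (Fin n) | ∀ s ∈ S, ∀ x ∈ X, ¬ (openGraph ω).Reachable s x},
          F (⋃ s ∈ S, openEdgeCluster ω s) * G (⋃ s ∈ S, openEdgeCluster ω s) ∂(prodBernoulli w) :=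
      bhkHub_setIntegral_transfer hL hD fun η _ => by simp only [hF', hG', hC]
    have e4 : (prodBernoulli hubW⟦S, w⟧).real
          {ω' : BondConfig (Option (Fin n)) | ∀ x ∈ X', ¬ (openGraph ω').Reachable none x} =
        (prodBernoulli w).real
          {ω : BondConfig (Fin n) | ∀ s ∈ S, ∀ x ∈ X, ¬ (openGraph ω).Reachable s x} :=
      bhkHub_measureReal_transfer hL hD
    rw [e1, e2, e3, e4] at key
    exact key
  · /- (ii): an inner hub attached to `S'` and an outer hub attached to `S`; BHK Thm. 1.4 for the two
    hubs, transported along the double lift. -/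
    intro n w S S' F G hF hG _
    set A₂ : Finset (Option (Fin n)) := S.image some with hA₂
    set L : Set (Sym2 (Fin n)) → Set (Sym2 (Option (Option (Fin n)))) :=
      fun η => hubLift⟦A₂, hubLift⟦S', η⟧⟧ with hLdef
    set w₂ : Sym2 (Option (Option (Fin n))) → unitInterval :=
      hubW⟦A₂, hubW⟦S', w⟧⟧ with hw₂
    set F₂ : Set (Sym2 (Option (Option (Fin n)))) → ℝ :=
      fun C => F (Sym2.map some ⁻¹' (Sym2.map some ⁻¹' C)) with hF₂
    set G₂ : Set (Sym2 (Option (Option (Fin n)))) → ℝ :=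
      fun C => G (Sym2.map some ⁻¹' (Sym2.map some ⁻¹' C)) with hG₂
    have hF₂m : Monotone F₂ := fun C C' h => hF (preimage_mono (preimage_mono h))
    have hG₂m : Monotone G₂ := fun C C' h => hG (preimage_mono (preimage_mono h))
    have hst : (none : Option (Option (Fin n))) ≠ some none := (Option.some_ne_none _).symm
    have key := BHK2006_twoClusterConditionalAssociation_holds.negCorrelation
      (Option (Option (Fin n))) w₂ none (some none) F₂ G₂ hF₂m hG₂m hst
    have hL : ∀ h : Set (Sym2 (Option (Option (Fin n)))) → ℝ,
        ∫ ξ, h ξ ∂(prodBernoulli w₂) = ∫ η, h (L η) ∂(prodBernoulli w) := fun h => by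
      rw [hw₂, bhkHub_integral, bhkHub_integral]
    -- the inner hub is joined to the outer attachment set iff `S ↔ S'`
    have htouch : ∀ η : Set (Sym2 (Fin n)),
        (∃ a ∈ A₂, (openGraph (hubLift⟦S', η⟧)).Reachable a none) ↔
          ∃ s ∈ S, ∃ x ∈ S', (openGraph η).Reachable s x := by
      intro η
      simp only [hA₂, Finset.mem_image, exists_exists_and_eq_and]
      refine exists_congr fun s => and_congr_right fun _ => ?_
      rw [SimpleGraph.reachable_comm, bhkHub_reachable_none_some]
      exact exists_congr fun x => and_congr_right fun _ => SimpleGraph.reachable_comm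
    have hD : ∀ η : Set (Sym2 (Fin n)),
        L η ∈ {ξ : BondConfig (Option (Option (Fin n))) | ¬ (openGraph ξ).Reachable none (some none)} ↔
          η ∈ {ω : BondConfig (Fin n) | ∀ s ∈ S, ∀ x ∈ S', ¬ (openGraph ω).Reachable s x} := by
      intro η
      simp only [mem_setOf_eq, hLdef, bhkHub_reachable_none_some, htouch, not_exists, not_and]
    have hCS : ∀ η ∈ {ω : BondConfig (Fin n) | ∀ s ∈ S, ∀ x ∈ S', ¬ (openGraph ω).Reachable s x},
        Sym2.map some ⁻¹' (Sym2.map some ⁻¹' openEdgeCluster (L η) none) =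
          ⋃ s ∈ S, openEdgeCluster η s := by
      intro η hη
      rw [mem_setOf_eq] at hη
      simp only [hLdef]
      rw [bhkHub_preimage_cluster_none, hA₂, Finset.set_biUnion_finset_image, preimage_iUnion₂]
      refine iUnion₂_congr fun s hs => bhkHub_preimage_cluster_some ?_
      rintro ⟨a, ha, has⟩
      exact hη s hs a ha has.symm
    have hCS' : ∀ η ∈ {ω : BondConfig (Fin n) | ∀ s ∈ S, ∀ x ∈ S', ¬ (openGraph ω).Reachable s x},
        Sym2.map some ⁻¹' (Sym2.map some ⁻¹' openEdgeCluster (L η) (some none)) =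
          ⋃ s ∈ S', openEdgeCluster η s := by
      intro η hη
      rw [mem_setOf_eq] at hη
      have hx : ¬ ∃ a ∈ A₂, (openGraph (hubLift⟦S', η⟧)).Reachable a none := fun h => by
        obtain ⟨s, hs, x, hx, hsx⟩ := (htouch η).1 h
        exact hη s hs x hx hsx
      simp only [hLdef]
      rw [bhkHub_preimage_cluster_some hx, bhkHub_preimage_cluster_none]
    have e1 : ∫ ξ in {ξ : BondConfig (Option (Option (Fin n))) | ¬ (openGraph ξ).Reachable none (some none)},
          F₂ (openEdgeCluster ξ none) * G₂ (openEdgeCluster ξ (some none)) ∂(prodBernoulli w₂) =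
        ∫ ω in {ω : BondConfig (Fin n) | ∀ s ∈ S, ∀ x ∈ S', ¬ (openGraph ω).Reachable s x},
          F (⋃ s ∈ S, openEdgeCluster ω s) * G (⋃ s ∈ S', openEdgeCluster ω s) ∂(prodBernoulli w) :=
      bhkHub_setIntegral_transfer hL hD fun η hη => by simp only [hF₂, hG₂, hCS η hη, hCS' η hη]
    have e2 : ∫ ξ in {ξ : BondConfig (Option (Option (Fin n))) | ¬ (openGraph ξ).Reachable none (some none)},
          F₂ (openEdgeCluster ξ none) ∂(prodBernoulli w₂) =
        ∫ ω in {ω : BondConfig (Fin n) | ∀ s ∈ S, ∀ x ∈ S', ¬ (openGraph ω).Reachable s x},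
          F (⋃ s ∈ S, openEdgeCluster ω s) ∂(prodBernoulli w) :=
      bhkHub_setIntegral_transfer hL hD fun η hη => by simp only [hF₂, hCS η hη]
    have e3 : ∫ ξ in {ξ : BondConfig (Option (Option (Fin n))) | ¬ (openGraph ξ).Reachable none (some none)},
          G₂ (openEdgeCluster ξ (some none)) ∂(prodBernoulli w₂) =
        ∫ ω in {ω : BondConfig (Fin n) | ∀ s ∈ S, ∀ x ∈ S', ¬ (openGraph ω).Reachable s x},
          G (⋃ s ∈ S', openEdgeCluster ω s) ∂(prodBernoulli w) :=
      bhkHub_setIntegral_transfer hL hD fun η hη => by simp only [hG₂, hCS' η hη]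
    have e4 : (prodBernoulli w₂).real
          {ξ : BondConfig (Option (Option (Fin n))) | ¬ (openGraph ξ).Reachable none (some none)} =
        (prodBernoulli w).real
          {ω : BondConfig (Fin n) | ∀ s ∈ S, ∀ x ∈ S', ¬ (openGraph ω).Reachable s x} :=
      bhkHub_measureReal_transfer hL hD
    rw [e1, e2, e3, e4] at key
    exact key

end

end Summit.CriticalPhenomena.PercolationContinuityZ3.Theorems
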